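import Literature.AlgebraicGeometry.Morphisms.ProjectiveOverLocalBaseOfFibreEmbedding
import Literature.AlgebraicGeometry.AbelianSchemes.PolarizedLevelFrameEmbedding
import Literature.AlgebraicGeometry.AbelianSchemes.DualIsogenyMulN
import Literature.AlgebraicGeometry.AbelianVarieties.LineBundleTensorPower
import Literature.AlgebraicGeometry.Motives.AlgPointsNilpotentThickening
import Literature.AlgebraicGeometry.Resolution.ResolutionCharZero
import Mathlib.RingTheory.Artinian.Ring
import HarnessLib

/-!
# An abelian scheme over an Artin local ring whose closed-fibre line bundle is a polarisation bundle is projective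

Informal result ([MumfordFogartyKirwan1994] Ch. 6 §3, proof of Prop. 6.15 / [EGAIII1] Thm. 4.7.1 / [MumfordAV1970] §5 Cor. 3 and
§16–§17).  Let `A` be an Artin local `ℚ`-algebra, `J ⊊ A` an ideal, `A₀ → Spec (A/J)` a polarised abelian scheme (polarisation
`λ₀` with graph datum `Gr₀`, Poincaré bundle `𝒫₀`, so `L^Δ(λ₀) = Gr₀^*𝒫₀`), `X → Spec A` an abelian scheme with a cartesian
morphism `G : A₀ → X` over `Spec (A/J) ↪ Spec A`, and `L` a line bundle on `X` with `G^*L ≅ L^Δ(λ₀)`.  Then `X → Spec A` is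
PROJECTIVE.  Indeed `M := L^{⊗3}` satisfies the hypotheses of ★ `Morphisms.isProjective_of_isLocalRing_of_fibre_fieldExtension_of_iso`
(EGA III 4.7.1 over a local base): every field-valued point of `Spec A` factors through `Spec (A/J)` (the Artin local ring has
one prime, containing `J`), so every field fibre of `(X, M)` is a field fibre of `(A₀, L^Δ(λ₀)^{⊗3})`, on which `H¹ = 0`
([MumfordAV1970] §16, ★ V4 `Polarization.subsingleton_ext_one_pullback_LDelta_tensorPow'`) and which, over the algebraic closure,
is embedded by any spanning family of sections ([MumfordAV1970] §17 Lefschetz, ★ `Polarization.exists_hcov_isClosedImmersion_toProj_fibre_LDelta_three`);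
a finite spanning family exists because the sections form a finite module over the field ([MumfordAV1970] §5 Cor. 2, ★
`Morphisms.finite_and_projective_secMod_top_of_forall_fiber`).  This is the «αP» junction of the deformation argument for the
smoothness of the Siegel moduli scheme: the lift of a polarised abelian scheme along a small extension, a priori only an abelian
scheme carrying a lifted line bundle, is projective.

References.
* [EGAIII1] A. Grothendieck, EGA III (première partie), Publ. Math. IHÉS 11 (1961), Thm. 4.7.1.
* [MumfordAV1970] D. Mumford, Abelian Varieties (1970), §5 Cor. 2 (p. 50), Cor. 3 (p. 53); §16 (vanishing theorem); §17 (Lefschetz).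
* [MumfordFogartyKirwan1994] D. Mumford, J. Fogarty, F. Kirwan, Geometric Invariant Theory, 3rd ed. (1994), Ch. 6 §3 Prop. 6.15 (p. 124)
  and its proof (p. 125); Ch. 6 §2 Prop. 6.10 (p. 121).
-/

noncomputable section

-- Mathlib's `Over` monoidal API and `Scheme.Modules` section API are stated across semireducible wrappers.
set_option backward.isDefEq.respectTransparency false

open CategoryTheory CategoryTheory.Limits CategoryTheory.Abelian AlgebraicGeometry TopologicalSpace Opposite
open Literature.AlgebraicGeometry.Modules Literature.AlgebraicGeometry.Motives
open Literature.AlgebraicGeometry.Motives.GeneratingSections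

namespace Literature.AlgebraicGeometry.AbelianSchemes

namespace AbelianSchemeOver

/-- `Spec (A/J) → Spec A` is onto for `A` Artin local and `J ≠ A`: the one prime `𝔪` of `A` contains `J`. [folklore]
[cite: MumfordFogartyKirwan1994, Ch. 6 §3 Prop. 6.15 (p. 124) and its proof (p. 125)] -/
theorem surjective_specMap_quotient_of_isArtinianRing_of_isLocalRing (A : Type) [CommRing A] [IsArtinianRing A]
    [IsLocalRing A] (J : Ideal A) (hJ : J ≠ ⊤) :
    Surjective (Spec.map (CommRingCat.ofHom (Ideal.Quotient.mk J))) := by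
  haveI : Nontrivial (A ⧸ J) := Ideal.Quotient.nontrivial_iff.mpr hJ
  refine ⟨fun y ↦ ?_⟩
  obtain ⟨M, hM⟩ := Ideal.exists_maximal (A ⧸ J)
  refine ⟨(⟨M, hM.isPrime⟩ : PrimeSpectrum (A ⧸ J)), PrimeSpectrum.ext ?_⟩
  rw [IsLocalRing.eq_maximalIdeal (IsArtinianRing.isMaximal_of_isPrime y.asIdeal)]
  change (Ideal.comap (Ideal.Quotient.mk J) M) = IsLocalRing.maximalIdeal A
  exact IsLocalRing.eq_maximalIdeal (Ideal.comap_isMaximal_of_surjective _ Ideal.Quotient.mk_surjective)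

/-- **An abelian scheme over an Artin local `ℚ`-algebra carrying a line bundle that restricts to `L^Δ(λ₀)` of a polarisation of
its restriction to `Spec (A/J)` is PROJECTIVE** (the «αP» junction; EGA III 4.7.1 over the local base `Spec A` at `M := L^{⊗3}`, fed
fibrewise — every field point of `Spec A` factors through `Spec (A/J)` — by Mumford §16 (`H¹ = 0`, ★ V4) and §17 (Lefschetz: the
geometric fibres are embedded by any spanning family of sections of `L^Δ(λ₀)^{⊗3}`, ★), a finite spanning family existing by §5 Cor. 2).
[cite: EGAIII1, Thm. 4.7.1] [cite: MumfordAV1970, §16 (the vanishing theorem)] [cite: MumfordAV1970, §17 (Lefschetz theorem)]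
[cite: MumfordFogartyKirwan1994, Ch. 6 §3 Prop. 6.15 (p. 124) and its proof (p. 125)] -/
theorem isProjective_of_isBaseChangeVia_of_iso_pullback_LDelta {A : Type} [CommRing A] [Algebra ℚ A] [IsArtinianRing A]
    [IsLocalRing A] (J : Ideal A) (hJ : J ≠ ⊤) (A₀ : AbelianSchemeOver (Spec (.of (A ⧸ J)))) (D₀ : A₀.DualPair)
    (pol₀ : A₀.Polarization D₀) (Gr₀ : A₀.X.left ⟶ A₀.prodLeft D₀.hat)
    (hGr₁ : Gr₀ ≫ pullback.fst A₀.X.hom D₀.hat.X.hom = 𝟙 _) (hGr₂ : Gr₀ ≫ pullback.snd A₀.X.hom D₀.hat.X.hom = pol₀.lam.left)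
    (X : AbelianSchemeOver (Spec (.of A))) (G : A₀.X.left ⟶ X.X.left)
    (hG : A₀.IsBaseChangeVia X (Spec.map (CommRingCat.ofHom (Ideal.Quotient.mk J))) G)
    (L : X.left.Modules) (hL : HasRank L 1)
    (hLΔ : Nonempty ((Scheme.Modules.pullback G).obj L ≅ (Scheme.Modules.pullback Gr₀).obj D₀.P)) :
    Morphisms.IsProjective X.X.hom := by
  classical
  obtain ⟨eΔ⟩ := hLΔ
  -- the two bases and the cartesian square of `G`
  haveI : IsProper X.X.hom := X.isProper
  haveI : Smooth X.X.hom := X.isSmooth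
  haveI : IsProper A₀.X.hom := A₀.isProper
  haveI : Smooth A₀.X.hom := A₀.isSmooth
  haveI : IsClosedImmersion (Spec.map (CommRingCat.ofHom (Ideal.Quotient.mk J))) :=
    IsClosedImmersion.spec_of_surjective _ Ideal.Quotient.mk_surjective
  haveI := surjective_specMap_quotient_of_isArtinianRing_of_isLocalRing A J hJ
  obtain ⟨w, hGpb, -, -⟩ := hG
  -- every field point of `Spec A` factors through `Spec (A/J)`
  have hfac : ∀ {K : Type} [Field K] (x : Spec (.of K) ⟶ Spec (.of A)),
      ∃ x₀ : Spec (.of K) ⟶ Spec (.of (A ⧸ J)), x₀ ≫ Spec.map (CommRingCat.ofHom (Ideal.Quotient.mk J)) = x :=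
    fun x ↦ exists_comp_eq_of_isClosedImmersion_of_surjective _ x
  -- `M := L^{⊗3}` with a rank-one frame system; `M₀ := L^Δ(λ₀)^{⊗3} = (Gr₀^*𝒫₀)^{⊗3}` with one; `G^*M ≅ M₀`
  obtain ⟨F, h1⟩ := exists_frameSystem_of_hasRank (hasRank_tensorPow_one hL 3)
  have hP : HasRank ((Scheme.Modules.pullback Gr₀).obj D₀.P) 1 := hasRank_of_iso eΔ (hasRank_pullback G hL)
  obtain ⟨F₀, h1₀⟩ := exists_frameSystem_of_hasRank (hasRank_tensorPow_one hP 3)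
  obtain ⟨ψ₁⟩ := nonempty_pullback_tensorPow_iso G hL 3
  obtain ⟨ψ₂⟩ := DualPair.nonempty_tensorPow_iso_of_iso eΔ 3
  let ψ : (Scheme.Modules.pullback G).obj (tensorPow L 3) ≅ tensorPow ((Scheme.Modules.pullback Gr₀).obj D₀.P) 3 := ψ₁ ≪≫ ψ₂
  -- (hvan) `H¹ = 0` on every field fibre of `(X, M)`: it is a field fibre of `(A₀, M₀)` — Mumford §16 (★ V4)
  have hvan : ∀ ⦃K : Type⦄ [Field K] ⦃X₀ : Scheme.{0}⦄ (i : X₀ ⟶ X.X.left) (f₀ : X₀ ⟶ Spec (.of K))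
      (x : Spec (.of K) ⟶ Spec (.of A)), IsPullback i f₀ X.X.hom x →
        Subsingleton (Ext.{1} (unitModule X₀) ((Scheme.Modules.pullback i).obj (tensorPow L 3)) 1) := by
    intro K _ X₀ i f₀ x H
    obtain ⟨x₀, hx₀⟩ := hfac x
    let i₀ : X₀ ⟶ A₀.X.left := hGpb.lift i (f₀ ≫ x₀) (by rw [H.w, ← hx₀, Category.assoc])
    have hi₀ : i₀ ≫ G = i := hGpb.lift_fst _ _ _
    have hi₀' : i₀ ≫ A₀.X.hom = f₀ ≫ x₀ := hGpb.lift_snd _ _ _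
    have H' : IsPullback (i₀ ≫ G) f₀ X.X.hom (x₀ ≫ Spec.map (CommRingCat.ofHom (Ideal.Quotient.mk J))) := by
      rw [hi₀, hx₀]; exact H
    have H₀ : IsPullback i₀ f₀ A₀.X.hom x₀ := IsPullback.of_right H' hi₀' hGpb
    haveI := pol₀.subsingleton_ext_one_pullback_LDelta_tensorPow' A₀ D₀ Gr₀ hGr₁ hGr₂ x₀ H₀ (m := 3) (by norm_num)
    refine Modules.subsingleton_ext_of_iso (unitModule X₀)
      (?_ : _ ≅ (Scheme.Modules.pullback i₀).obj (tensorPow ((Scheme.Modules.pullback Gr₀).obj D₀.P) 3)) 1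
    exact eqToIso (by rw [← hi₀]) ≪≫ ((Scheme.Modules.pullbackComp i₀ G).app _).symm ≪≫
      (Scheme.Modules.pullback i₀).mapIso ψ
  -- (H) at every point of `Spec A`: the geometric fibre of `A₀` over `κ(t)̄`, embedded by a spanning family (Lefschetz)
  refine Morphisms.isProjective_of_isLocalRing_of_fibre_fieldExtension_of_iso X.X.hom F h1 hvan fun t ↦ ?_
  haveI : CharZero ((Spec (.of A)).residueField t) :=
    Resolution.charZero_residueField_of_over_field (Spec.map (CommRingCat.ofHom (algebraMap ℚ A))) t
  let K : Type := AlgebraicClosure ((Spec (.of A)).residueField t)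
  let j : (Spec (.of A)).residueField t →+* K := algebraMap _ K
  obtain ⟨iK₀, hiK₀⟩ := hfac (Spec.map (CommRingCat.ofHom j) ≫ (Spec (.of A)).fromSpecResidueField t)
  -- the fibre `X₀ := A₀ ×_{Spec (A/J)} Spec K`, a fibre of `X` over `Spec K → Spec A`
  have HX₀ : IsPullback (pullback.fst A₀.X.hom iK₀) (pullback.snd A₀.X.hom iK₀) A₀.X.hom iK₀ := IsPullback.of_hasPullback _ _
  have HX : IsPullback (pullback.fst A₀.X.hom iK₀ ≫ G) (pullback.snd A₀.X.hom iK₀) X.X.hom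
      (Spec.map (CommRingCat.ofHom j) ≫ (Spec (.of A)).fromSpecResidueField t) := by
    rw [← hiK₀]; exact HX₀.paste_horiz hGpb
  -- `M₀|_{X₀}` is finite locally free with `H¹ = 0` on the canonical fibres of `X₀ → Spec K` (★ V4 again): its sections form a
  -- finite `K`-module (Mumford §5 Cor. 2), whence a finite spanning family `s` (padded by `0` to `n + 1` members)
  have hvan₀ : ∀ y : Spec (.of K), Subsingleton (Ext.{1} (unitModule ((pullback.snd A₀.X.hom iK₀).fiber y))
      ((Scheme.Modules.pullback ((pullback.snd A₀.X.hom iK₀).fiberι y)).obj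
        ((Scheme.Modules.pullback (pullback.fst A₀.X.hom iK₀)).obj
          (tensorPow ((Scheme.Modules.pullback Gr₀).obj D₀.P) 3))) 1) := by
    intro y
    have Hy : IsPullback ((pullback.snd A₀.X.hom iK₀).fiberι y ≫ pullback.fst A₀.X.hom iK₀)
        ((pullback.snd A₀.X.hom iK₀).fiberToSpecResidueField y) A₀.X.hom
        ((Spec (.of K)).fromSpecResidueField y ≫ iK₀) :=
      (IsPullback.of_hasPullback (pullback.snd A₀.X.hom iK₀) ((Spec (.of K)).fromSpecResidueField y)).paste_horiz HX₀
    haveI := pol₀.subsingleton_ext_one_pullback_LDelta_tensorPow' A₀ D₀ Gr₀ hGr₁ hGr₂ _ Hy (m := 3) (by norm_num)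
    exact Modules.subsingleton_ext_of_iso (unitModule _)
      ((Scheme.Modules.pullbackComp ((pullback.snd A₀.X.hom iK₀).fiberι y) (pullback.fst A₀.X.hom iK₀)).app _) 1
  obtain ⟨hfin, -⟩ := Morphisms.finite_and_projective_secMod_top_of_forall_fiber (pullback.snd A₀.X.hom iK₀)
    ((Scheme.Modules.pullback (pullback.fst A₀.X.hom iK₀)).obj (tensorPow ((Scheme.Modules.pullback Gr₀).obj D₀.P) 3))
    (F₀.pullback (pullback.fst A₀.X.hom iK₀)).isFiniteLocallyFree hvan₀
  haveI := hfin
  obtain ⟨n, σ, hσ⟩ := Module.Finite.exists_fin (R := Γ(Spec (.of K), ⊤))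
    (M := SecMod ((Scheme.Modules.pullback (pullback.fst A₀.X.hom iK₀)).obj
      (tensorPow ((Scheme.Modules.pullback Gr₀).obj D₀.P) 3)) (pullback.snd A₀.X.hom iK₀).appTop.hom ⊤)
  let s : Fin (n + 1) → Γ((Scheme.Modules.pullback (pullback.fst A₀.X.hom iK₀)).obj
      (tensorPow ((Scheme.Modules.pullback Gr₀).obj D₀.P) 3), ⊤) :=
    Fin.cons 0 fun k ↦ SecMod.val (ρ := (pullback.snd A₀.X.hom iK₀).appTop.hom) (σ k)
  have hs : ∀ τ : Γ((Scheme.Modules.pullback (pullback.fst A₀.X.hom iK₀)).obj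
      (tensorPow ((Scheme.Modules.pullback Gr₀).obj D₀.P) 3), ⊤),
      SecMod.mk (L := (Scheme.Modules.pullback (pullback.fst A₀.X.hom iK₀)).obj
          (tensorPow ((Scheme.Modules.pullback Gr₀).obj D₀.P) 3))
        (ρ := (pullback.snd A₀.X.hom iK₀).appTop.hom) (U := ⊤) τ ∈
        Submodule.span Γ(Spec (.of K), ⊤) (Set.range fun k ↦
          SecMod.mk (L := (Scheme.Modules.pullback (pullback.fst A₀.X.hom iK₀)).obj
            (tensorPow ((Scheme.Modules.pullback Gr₀).obj D₀.P) 3))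
            (ρ := (pullback.snd A₀.X.hom iK₀).appTop.hom) (U := ⊤) (s k)) := by
    intro τ
    refine Submodule.span_mono ?_ (hσ.symm ▸ Submodule.mem_top)
    rintro _ ⟨k, rfl⟩
    exact ⟨k.succ, by simp only [s, Fin.cons_succ, SecMod.mk_val]⟩
  obtain ⟨hcov, hemb⟩ := Polarization.exists_hcov_isClosedImmersion_toProj_fibre_LDelta_three A₀ D₀ pol₀ Gr₀ hGr₁ hGr₂
    F₀ h1₀ iK₀ s hs
  -- the model isomorphism `M₀|_{X₀} ≅ (fst ≫ G)^* M`
  let φ : (Scheme.Modules.pullback (pullback.fst A₀.X.hom iK₀)).obj (tensorPow ((Scheme.Modules.pullback Gr₀).obj D₀.P) 3) ≅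
      (Scheme.Modules.pullback (pullback.fst A₀.X.hom iK₀ ≫ G)).obj (tensorPow L 3) :=
    ((Scheme.Modules.pullback (pullback.fst A₀.X.hom iK₀)).mapIso ψ).symm ≪≫
      (Scheme.Modules.pullbackComp (pullback.fst A₀.X.hom iK₀) G).app _
  exact ⟨K, inferInstance, j, _, pullback.fst A₀.X.hom iK₀ ≫ G, pullback.snd A₀.X.hom iK₀, HX, _, φ,
    F₀.pullback (pullback.fst A₀.X.hom iK₀), fun x => h1₀ ((pullback.fst A₀.X.hom iK₀).base x), n, s, hcov, hemb⟩

end AbelianSchemeOver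

end Literature.AlgebraicGeometry.AbelianSchemes

end
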